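import Summits.ValiantsHypothesis.ValiantsHypothesis.Theorems.SymPencilSingFiveLeafCrossArm

/-!
# Route `SymPencil` — R11 `(11, 5, 5)` at `m ≤ 28`: LEAF X AT FIVE SQUARES, part 1 (the arm lemma)
# (`--supports` stmt-ValiantsHypothesis-5674 `SdcSuperquadratic`; rung currency only — nothing here bears on `VP ≠ VNP`)

The size-27 cell `(11, 5, 4)` closed leaf X of val-idea-18's Sing-5 cascade with a per-direction family of `≤ 4` squares
(✓ `SymPencilSingFiveLeafCrossArm` / ✓ `SymPencilSingFiveLeafCross`).  Row `r = 11` of the `m = 28` table needs the SAME leaf with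
`≤ 5` squares (`c : Fin 5 → K`, `Λ : Fin 5 → _`).  By the RE-CUT RULE (desk #468 (A) / #485 (A); critic val-idea-crit-5 g4) only the
declarations whose TYPE changes under `Fin 4 ↦ Fin 5` (square index) are re-declared, suffixed `_five` (val-port-3 g4's naming, cited from its dispatch/cell file), texts otherwise VERBATIM from
val-port-3 g4's copy-compile `pub/val-lit/lmr/staged/port3g4-r11/R11F-copycompile.lean` 683855380e46eebf (generator `build_r11.py`
aa2fef8accdbb8e7); the unchanged `exists_span_of_support` is CITED BY NAME from ✓ `SymPencilSingFiveLeafCrossArm`.  Two files (400-line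
rule), mirroring the tree's own split: this part = `colArm_eq_zero_of_sum_sq_five`; part 2 = `SymPencilSingFiveLeafCrossFive`.

* `colArm_eq_zero_of_sum_sq_five` — the Kronecker form under FIVE squares still forces the column arm to vanish at a cross element with
  non-zero row-arm product: the evaluation map `K^{3×3} → K^5` has kernel of dimension `≥ 9 − 5 = 4` (val-lit-p8 g16's fix (i):
  `hker5 : 4 ≤ …`, range `≤ 5`), and `4 > 3` is all the end-contradiction uses.  (The cross Gram has rank `6/9`, so no «five ⇒ four»
  bridge exists for this leaf — the copy is forced; port-3 g4 (a″).)

Honest framing: [folklore] linear algebra, a re-typed copy; R11 is OPEN until (a″)(b)(c)(d) land and crit-5 licenses the words; the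
`m = 28` table stands 3/6; `28 ≤ sdc(per₄) ≤ 29` unchanged («= 29» forbidden until 6/6); the crux `SdcSuperquadratic`, 5674 and `VP ≠ VNP`
untouched; no summit statement is proved here.  No definitions, no named facts.
-/

noncomputable section

-- single-conjunct layout: Sub = Summit, duplicated namespace component intended
set_option linter.dupNamespace false

namespace Summit.ValiantsHypothesis.ValiantsHypothesis.Theorems.SymPencilSingFiveClassification

open MvPolynomial Module Matrix
open scoped Polynomial
open Literature.Computability.AlgebraicComplexity
open Summit.ValiantsHypothesis.ValiantsHypothesis.Theorems
open Summit.ValiantsHypothesis.ValiantsHypothesis.Theorems.SymPencilSingSixClassification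
open Summit.ValiantsHypothesis.ValiantsHypothesis.Theorems.SymPencilPerFourJointFamilyTransport

variable {K : Type*} [Field K]

/-- **Kronecker form with FIVE squares** (R11 copy at five of ✓ `colArm_eq_zero_of_sum_sq_four`; pointwise core of leaf X,
memo §3): for `y ∈ X₃₃` with a per-direction family of `≤ 5` squares, a row arm with non-zero product forces the column arm
to vanish (the kernel of the `9 → 5` evaluation map has dimension `≥ 4`, and `≥ 4 > 3` still contradicts the row-determination). [folklore] -/
theorem colArm_eq_zero_of_sum_sq_five [CharZero K] (y : Fin 4 × Fin 4 → K)
    (hy : ∀ i j : Fin 4, i ≠ 3 → j ≠ 3 → y (i, j) = 0) (c : Fin 5 → K)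
    (Λ : Fin 5 → ((Fin 4 × Fin 4 → K) →ₗ[K] K))
    (hfam : ∀ u : Fin 4 × Fin 4 → K, ∃ e₀ e₁ : K, ∀ s : K,
      eval (u + s • y) (perPoly (Fin 4) K) = e₀ + s * e₁ + s ^ 2 * ∑ k, c k * (Λ k u) ^ 2)
    (ha : y (3, 0) * y (3, 1) * y (3, 2) ≠ 0) :
    y (0, 3) = 0 ∧ y (1, 3) = 0 ∧ y (2, 3) = 0 := by
  classical
  have ha' : y (3, 2) * y (3, 1) * y (3, 0) ≠ 0 := by
    intro h; apply ha; linear_combination h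
  obtain ⟨f01, f02, f10, f12, f20, f21⟩ :
      (((0 : Fin 3) = 1) = False) ∧ (((0 : Fin 3) = 2) = False) ∧
      (((1 : Fin 3) = 0) = False) ∧ (((1 : Fin 3) = 2) = False) ∧
      (((2 : Fin 3) = 0) = False) ∧ (((2 : Fin 3) = 1) = False) := by
    refine ⟨?_, ?_, ?_, ?_, ?_, ?_⟩ <;> decide
  obtain ⟨U, hU⟩ := SymPencilPerFourCrossKronecker.exists_blockEmbedding (K := K)
  obtain ⟨Q, hQ⟩ : ∃ Q : (Fin 3 × Fin 3 → K) → K, ∀ w, Q w =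
      y (0, 3) * y (3, 0) * (w (1, 1) * w (2, 2) + w (1, 2) * w (2, 1)) +
        y (0, 3) * y (3, 1) * (w (1, 0) * w (2, 2) + w (1, 2) * w (2, 0)) +
        y (0, 3) * y (3, 2) * (w (1, 0) * w (2, 1) + w (1, 1) * w (2, 0)) +
        y (1, 3) * y (3, 0) * (w (0, 1) * w (2, 2) + w (0, 2) * w (2, 1)) +
        y (1, 3) * y (3, 1) * (w (0, 0) * w (2, 2) + w (0, 2) * w (2, 0)) +
        y (1, 3) * y (3, 2) * (w (0, 0) * w (2, 1) + w (0, 1) * w (2, 0)) +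
        y (2, 3) * y (3, 0) * (w (0, 1) * w (1, 2) + w (0, 2) * w (1, 1)) +
        y (2, 3) * y (3, 1) * (w (0, 0) * w (1, 2) + w (0, 2) * w (1, 0)) +
        y (2, 3) * y (3, 2) * (w (0, 0) * w (1, 1) + w (0, 1) * w (1, 0)) := ⟨_, fun _ => rfl⟩
  have hB : ∀ w : Fin 3 × Fin 3 → K, ∑ k, c k * (Λ k (U w)) ^ 2 = Q w := by
    intro w
    obtain ⟨e₀, e₁, he⟩ := hfam (U w)
    have hA := SymPencilPerFourCrossKronecker.eval_cross_block y hy U hU w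
    rw [hQ]
    exact SymPencilPerFourCrossPairNoJoint.coeff_two_eq_of_forall₂ (fun s => (he s).symm.trans (hA s))
  let M : (Fin 3 × Fin 3 → K) →ₗ[K] (Fin 5 → K) := LinearMap.pi fun k => (Λ k).comp U
  have hM : ∀ n k, M n k = Λ k (U n) := fun n k => rfl
  have hker5 : 4 ≤ finrank K (LinearMap.ker M) := by
    have h := LinearMap.finrank_range_add_finrank_ker M
    have hr : finrank K (LinearMap.range M) ≤ 5 :=
      calc finrank K (LinearMap.range M) ≤ finrank K (Fin 5 → K) := Submodule.finrank_le _
        _ = 5 := by rw [Module.finrank_fintype_fun_eq_card, Fintype.card_fin]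
    rw [Module.finrank_fintype_fun_eq_card, Fintype.card_prod, Fintype.card_fin] at h
    omega
  obtain ⟨E, hE⟩ : ∃ E : Fin 3 × Fin 3 → (Fin 3 × Fin 3 → K), ∀ P p, E P p = if p = P then 1 else 0 :=
    ⟨fun P p => if p = P then 1 else 0, fun _ _ => rfl⟩
  have key : ∀ n ∈ LinearMap.ker M,
      (y (2, 3) * n (1, 0) + y (1, 3) * n (2, 0) = 0 ∧ y (2, 3) * n (1, 1) + y (1, 3) * n (2, 1) = 0 ∧
        y (2, 3) * n (1, 2) + y (1, 3) * n (2, 2) = 0) ∧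
      (y (2, 3) * n (0, 0) + y (0, 3) * n (2, 0) = 0 ∧ y (2, 3) * n (0, 1) + y (0, 3) * n (2, 1) = 0 ∧
        y (2, 3) * n (0, 2) + y (0, 3) * n (2, 2) = 0) ∧
      (y (1, 3) * n (0, 0) + y (0, 3) * n (1, 0) = 0 ∧ y (1, 3) * n (0, 1) + y (0, 3) * n (1, 1) = 0 ∧
        y (1, 3) * n (0, 2) + y (0, 3) * n (1, 2) = 0) := by
    intro n hn
    have hΛ0 : ∀ k, Λ k (U n) = 0 := fun k => by
      have := congr_fun (LinearMap.mem_ker.1 hn) k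
      rwa [hM] at this
    have hQn : Q n = 0 := by
      rw [← hB n]
      exact Finset.sum_eq_zero fun k _ => by rw [hΛ0 k]; ring
    have hQadd : ∀ e : Fin 3 × Fin 3 → K, Q (n + e) = Q e := by
      intro e
      rw [← hB (n + e), ← hB e]
      exact Finset.sum_congr rfl fun k _ => by rw [map_add, map_add, hΛ0 k, zero_add]
    have r00 := hQadd (E (0, 0))
    have r01 := hQadd (E (0, 1))
    have r02 := hQadd (E (0, 2))
    have r10 := hQadd (E (1, 0))
    have r11 := hQadd (E (1, 1))
    have r12 := hQadd (E (1, 2))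
    have r20 := hQadd (E (2, 0))
    have r21 := hQadd (E (2, 1))
    have r22 := hQadd (E (2, 2))
    simp only [hQ, hE, Pi.add_apply, Prod.mk.injEq, f01, f02, f10, f12, f20, f21, and_true,
      and_false, if_true, if_false] at r00 r01 r02 r10 r11 r12 r20 r21 r22 hQn
    refine ⟨?_, ?_, ?_⟩
    · exact SymPencilPerFourHessianMinors.eq_zero_of_pairing₃ ha'
        (z₀ := y (2, 3) * n (1, 0) + y (1, 3) * n (2, 0))
        (z₁ := y (2, 3) * n (1, 1) + y (1, 3) * n (2, 1))
        (z₂ := y (2, 3) * n (1, 2) + y (1, 3) * n (2, 2))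
        (by linear_combination r00 - hQn) (by linear_combination r01 - hQn)
        (by linear_combination r02 - hQn)
    · exact SymPencilPerFourHessianMinors.eq_zero_of_pairing₃ ha'
        (z₀ := y (2, 3) * n (0, 0) + y (0, 3) * n (2, 0))
        (z₁ := y (2, 3) * n (0, 1) + y (0, 3) * n (2, 1))
        (z₂ := y (2, 3) * n (0, 2) + y (0, 3) * n (2, 2))
        (by linear_combination r10 - hQn) (by linear_combination r11 - hQn)
        (by linear_combination r12 - hQn)
    · exact SymPencilPerFourHessianMinors.eq_zero_of_pairing₃ ha'
        (z₀ := y (1, 3) * n (0, 0) + y (0, 3) * n (1, 0))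
        (z₁ := y (1, 3) * n (0, 1) + y (0, 3) * n (1, 1))
        (z₂ := y (1, 3) * n (0, 2) + y (0, 3) * n (1, 2))
        (by linear_combination r20 - hQn) (by linear_combination r21 - hQn)
        (by linear_combination r22 - hQn)
  have hproj : ∀ i : Fin 3, (∀ n ∈ LinearMap.ker M, (∀ j, n (i, j) = 0) → n = 0) →
      finrank K (LinearMap.ker M) ≤ 3 := by
    intro i hi
    let ρ : (Fin 3 × Fin 3 → K) →ₗ[K] (Fin 3 → K) := LinearMap.funLeft K K fun j => (i, j)
    have hρ : ∀ n j, ρ n j = n (i, j) := fun _ _ => rfl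
    have hinj : Function.Injective (ρ.domRestrict (LinearMap.ker M)) := by
      intro n n' h
      apply Subtype.ext
      have h2 : ρ (n : Fin 3 × Fin 3 → K) = ρ n' := by
        simpa only [LinearMap.domRestrict_apply] using h
      have h3 := hi ((n : Fin 3 × Fin 3 → K) - n') (Submodule.sub_mem _ n.2 n'.2) fun j => by
        have := congr_fun h2 j
        rw [hρ, hρ] at this
        rw [Pi.sub_apply, this, sub_self]
      exact sub_eq_zero.mp h3
    calc finrank K (LinearMap.ker M) ≤ finrank K (Fin 3 → K) :=
        LinearMap.finrank_le_finrank_of_injective hinj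
      _ = 3 := by rw [Module.finrank_fintype_fun_eq_card, Fintype.card_fin]
  by_contra hb
  have hcases : y (0, 3) ≠ 0 ∨ y (1, 3) ≠ 0 ∨ y (2, 3) ≠ 0 := by
    by_contra h
    push Not at h
    exact hb ⟨h.1, h.2.1, h.2.2⟩
  have h3 : finrank K (LinearMap.ker M) ≤ 3 := by
    rcases hcases with h0 | h1 | h2
    · -- `b₀ ≠ 0`: rows `1, 2` are determined by row `0`
      refine hproj 0 fun n hn hz => ?_
      obtain ⟨⟨-, -, -⟩, ⟨m10, m11, m12⟩, ⟨m20, m21, m22⟩⟩ := key n hn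
      have z0 := hz 0
      have z1 := hz 1
      have z2 := hz 2
      have e20 : y (0, 3) * n (2, 0) = 0 := by linear_combination m10 - y (2, 3) * z0
      have e21 : y (0, 3) * n (2, 1) = 0 := by linear_combination m11 - y (2, 3) * z1
      have e22 : y (0, 3) * n (2, 2) = 0 := by linear_combination m12 - y (2, 3) * z2
      have e10 : y (0, 3) * n (1, 0) = 0 := by linear_combination m20 - y (1, 3) * z0
      have e11 : y (0, 3) * n (1, 1) = 0 := by linear_combination m21 - y (1, 3) * z1
      have e12 : y (0, 3) * n (1, 2) = 0 := by linear_combination m22 - y (1, 3) * z2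
      have n20 := (mul_eq_zero.1 e20).resolve_left h0
      have n21 := (mul_eq_zero.1 e21).resolve_left h0
      have n22 := (mul_eq_zero.1 e22).resolve_left h0
      have n10 := (mul_eq_zero.1 e10).resolve_left h0
      have n11 := (mul_eq_zero.1 e11).resolve_left h0
      have n12 := (mul_eq_zero.1 e12).resolve_left h0
      funext p
      obtain ⟨i, j⟩ := p
      fin_cases i <;> fin_cases j
      · exact z0
      · exact z1
      · exact z2
      · exact n10
      · exact n11
      · exact n12
      · exact n20
      · exact n21
      · exact n22
    · -- `b₁ ≠ 0`: rows `0, 2` are determined by row `1`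
      refine hproj 1 fun n hn hz => ?_
      obtain ⟨⟨m00, m01, m02⟩, ⟨-, -, -⟩, ⟨m20, m21, m22⟩⟩ := key n hn
      have z0 := hz 0
      have z1 := hz 1
      have z2 := hz 2
      have e20 : y (1, 3) * n (2, 0) = 0 := by linear_combination m00 - y (2, 3) * z0
      have e21 : y (1, 3) * n (2, 1) = 0 := by linear_combination m01 - y (2, 3) * z1
      have e22 : y (1, 3) * n (2, 2) = 0 := by linear_combination m02 - y (2, 3) * z2
      have e00 : y (1, 3) * n (0, 0) = 0 := by linear_combination m20 - y (0, 3) * z0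
      have e01 : y (1, 3) * n (0, 1) = 0 := by linear_combination m21 - y (0, 3) * z1
      have e02 : y (1, 3) * n (0, 2) = 0 := by linear_combination m22 - y (0, 3) * z2
      have n20 := (mul_eq_zero.1 e20).resolve_left h1
      have n21 := (mul_eq_zero.1 e21).resolve_left h1
      have n22 := (mul_eq_zero.1 e22).resolve_left h1
      have n00 := (mul_eq_zero.1 e00).resolve_left h1
      have n01 := (mul_eq_zero.1 e01).resolve_left h1
      have n02 := (mul_eq_zero.1 e02).resolve_left h1
      funext p
      obtain ⟨i, j⟩ := p
      fin_cases i <;> fin_cases j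
      · exact n00
      · exact n01
      · exact n02
      · exact z0
      · exact z1
      · exact z2
      · exact n20
      · exact n21
      · exact n22
    · -- `b₂ ≠ 0`: rows `0, 1` are determined by row `2`
      refine hproj 2 fun n hn hz => ?_
      obtain ⟨⟨m00, m01, m02⟩, ⟨m10, m11, m12⟩, ⟨-, -, -⟩⟩ := key n hn
      have z0 := hz 0
      have z1 := hz 1
      have z2 := hz 2
      have e10 : y (2, 3) * n (1, 0) = 0 := by linear_combination m00 - y (1, 3) * z0
      have e11 : y (2, 3) * n (1, 1) = 0 := by linear_combination m01 - y (1, 3) * z1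
      have e12 : y (2, 3) * n (1, 2) = 0 := by linear_combination m02 - y (1, 3) * z2
      have e00 : y (2, 3) * n (0, 0) = 0 := by linear_combination m10 - y (0, 3) * z0
      have e01 : y (2, 3) * n (0, 1) = 0 := by linear_combination m11 - y (0, 3) * z1
      have e02 : y (2, 3) * n (0, 2) = 0 := by linear_combination m12 - y (0, 3) * z2
      have n10 := (mul_eq_zero.1 e10).resolve_left h2
      have n11 := (mul_eq_zero.1 e11).resolve_left h2
      have n12 := (mul_eq_zero.1 e12).resolve_left h2
      have n00 := (mul_eq_zero.1 e00).resolve_left h2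
      have n01 := (mul_eq_zero.1 e01).resolve_left h2
      have n02 := (mul_eq_zero.1 e02).resolve_left h2
      funext p
      obtain ⟨i, j⟩ := p
      fin_cases i <;> fin_cases j
      · exact n00
      · exact n01
      · exact n02
      · exact n10
      · exact n11
      · exact n12
      · exact z0
      · exact z1
      · exact z2
  omega

end Summit.ValiantsHypothesis.ValiantsHypothesis.Theorems.SymPencilSingFiveClassification

end
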